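import Summits.ResolutionOfSingularities.ResolutionOfSingularities.Theorems.MarkedTransferCampaignW46MohWindowSurfacePoly
import Literature.AlgebraicGeometry.Resolution.BlowupChartRsop
import Mathlib.RingTheory.PrincipalIdealDomain
import HarnessLib

/-!
# [OURS · L1 W4.6 rung (iii-2), piece (T)] Surface Moh window — the REES CHART at a point over a tame window point: the data
# of the core inequality (cell res-hironaka, LADDER-RESOLUTION rung L, D-0089; unit res-L1-s46-pv-12 carried by res-D-pv-050;
# host MarkedTransfer, `--supports stmt-ResolutionOfSingularities-16155 --as helper`)

HONEST FRAMING. Nothing here is a statement of H. Hironaka's manuscript [Hironaka2017] and nothing here asserts that any statement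
of it holds. PURE COMMUTATIVE ALGEBRA in the chart ring `B = R[𝔪/c_i]` of the blow-up of the closed point of a regular local ring
`R` with regular system of parameters `c = (c₀, c₁, c₂)` (tree `Resolution/BlowupChartRsop.lean`: `chartRing`, `chartBase`,
`chartGen`, `chartQuotEquiv : (R/𝔪)[Y, Z] ≃ B/(c_i)`, `isRsopPart_chartFamily_reesChart`), at a prime `𝔴 ⊇ 𝔪B` whose local ring
`L = B_𝔴` has embedding dimension `3` and contains the letter `e₂ = c₂/c_i` in its maximal ideal (the only location where the
transform of a window germ `c₂^p + Σ a_k c_i^{d−u_k} c_{i'}^{u_k}` can be singular, `i ∈ {0, 1}` the chart letter, `i'` the free one):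
`exists_core_data` produces `ρ, G ∈ L` and `μ < p` with `𝔪_L = (c_i, ρ, e₂)`, `G` a unit and
`Σ a_k e_{i'}^{u_k} ≡ ρ^μ G (mod c_i)` — from the structure of the exceptional plane `κ[Y, Z]` (companion `…Poly.lean`) and TAMENESS
of the residue polynomial `Σ ā_k X^{u_k}`. This is exactly the input of `MohWindowSurface.core` (companion `…Core.lean`).
AI-written; AI review is weaker than expert review. No `sorry`; axioms standard. [folklore]
-/

noncomputable section

set_option linter.dupNamespace false -- mandated namespace of this single-conjunct summit

namespace Summit.ResolutionOfSingularities.ResolutionOfSingularities.Theorems.CampaignW46.MohWindowSurface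

open IsLocalRing Polynomial
open Literature.AlgebraicGeometry.Resolution

universe u

variable {R : Type u} [CommRing R] [IsRegularLocalRing R]

/-! ## 1. The regular system of parameters `c : Fin 3 → R` padded for the chart API -/

omit [IsRegularLocalRing R] in
/-- `Fin.append c (nothing)` has the same range as `c`. [folklore] -/
theorem span_range_append_elim0 (c : Fin 3 → R) :
    Ideal.span (Set.range (Fin.append c (fun k : Fin 0 => Fin.elim0 k : Fin 0 → R))) = Ideal.span (Set.range c) := by
  congr 1
  ext r
  constructor
  · rintro ⟨i, rfl⟩
    refine Fin.addCases (fun k => ⟨k, ?_⟩) (fun k => Fin.elim0 k) i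
    rw [Fin.append_left]
  · rintro ⟨k, rfl⟩
    exact ⟨Fin.castAdd 0 k, by rw [Fin.append_left]⟩

omit [IsRegularLocalRing R] in
/-- The two letters of the exceptional plane of the chart `i`: every index `≠ i` is the free index `i'` or `2`, when
`i, i' ≠ 2` are distinct. [folklore] -/
theorem subtype_eq_or_eq {i i' : Fin 3} (hi : i ≠ 2) (hi' : i' ≠ 2) (hii' : i ≠ i') (s : {j : Fin 3 // j ≠ i}) :
    s = ⟨i', fun h => hii' h.symm⟩ ∨ s = ⟨2, fun h => hi h.symm⟩ := by
  obtain ⟨s, hs⟩ := s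
  simp only [Subtype.mk.injEq]
  fin_cases i <;> fin_cases i' <;> fin_cases s <;> simp_all

/-! ## 2. The data of the core inequality — abstract chart datum -/

omit [IsRegularLocalRing R] in
/-- **[OURS · L1 W4.6 rung (iii-2)] Abstract form of the chart computation.** `R` a local ring with residue field `κ`; a «chart
datum»: rings `B → L` (`alg`), `φ : R → B`, an exceptional equation `t ∈ B`, letters `e : Fin 3 → B`, an identification
`θ : κ[X_j : j ≠ i] ≃ B/(t)` sending `ā ↦ φ a` and `X_j ↦ e_j`, a prime `𝔴 ∋ t, e₂` of `B` such that `L` behaves like `B_𝔴`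
(`alg b ∈ 𝔪_L ↔ b ∈ 𝔴`, `alg b` a unit `↔ b ∉ 𝔴`, `𝔪_L = 𝔴 L`) and `𝔪_L` needs three generators. If the residue polynomial
`Σ ā_k X^{u_k}` (`u_k ≤ d < 2p`) is TAME, then for some `ρ, G ∈ L`, `μ < p`: `𝔪_L = (t, ρ, e₂)`, `G` is a unit and
`Σ_k φ(a_k) e_{i'}^{u_k} ≡ ρ^μ G (mod t)` in `L`. NOT a statement of the manuscript. [folklore] -/
theorem exists_core_data_of_chartDatum [IsLocalRing R] (p : ℕ) [Fact p.Prime] {B L : Type u} [CommRing B] [CommRing L]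
    [IsLocalRing L] (φ : R →+* B) (alg : B →+* L) (t : B) (e : Fin 3 → B) {i i' : Fin 3} (hi : i ≠ 2) (hi' : i' ≠ 2)
    (hii' : i ≠ i') (θ : MvPolynomial {j : Fin 3 // j ≠ i} (ResidueField R) ≃+* B ⧸ Ideal.span {t})
    (hθC : ∀ r : R, θ (MvPolynomial.C (residue R r)) = Ideal.Quotient.mk (Ideal.span {t}) (φ r))
    (hθX : ∀ s : {j : Fin 3 // j ≠ i}, θ (MvPolynomial.X s) = Ideal.Quotient.mk (Ideal.span {t}) (e s.1))
    (𝔴 : Ideal B) [𝔴.IsPrime] (ht𝔴 : t ∈ 𝔴) (hz : e 2 ∈ 𝔴)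
    (hmem : ∀ b : B, alg b ∈ maximalIdeal L ↔ b ∈ 𝔴) (hunit : ∀ b : B, IsUnit (alg b) ↔ b ∉ 𝔴)
    (hmL : maximalIdeal L = 𝔴.map alg) (h3L : (maximalIdeal L).spanFinrank = 3)
    {d : ℕ} (hd2 : d < 2 * p) (a : ℕ → R) (u : ℕ → ℕ) (hu : ∀ k, u k ≤ d)
    (htame : ∀ τ : ResidueField R, ¬ (X - C τ) ^ p ∣
      ∑ k ∈ Finset.range (d + 1), C (residue R (a k)) * X ^ (u k)) :
    ∃ (ρ G : L) (μ : ℕ), μ < p ∧ IsUnit G ∧ Ideal.span {alg t, ρ, alg (e 2)} = maximalIdeal L ∧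
      (∑ k ∈ Finset.range (d + 1), alg (φ (a k)) * alg (e i') ^ (u k)) - ρ ^ μ * G ∈ Ideal.span {alg t} := by
  classical
  set sY : {j : Fin 3 // j ≠ i} := ⟨i', fun h => hii' h.symm⟩ with hsY
  set sZ : {j : Fin 3 // j ≠ i} := ⟨2, fun h => hi h.symm⟩ with hsZ
  have hσ : ∀ s : {j : Fin 3 // j ≠ i}, s = sY ∨ s = sZ := subtype_eq_or_eq hi hi' hii'
  -- the prime `𝔴̄` of `B/(t)` and its pull-back `𝔫` to `κ[Y, Z]`
  have hK𝔴 : Ideal.span {t} ≤ 𝔴 := by rw [Ideal.span_le, Set.singleton_subset_iff]; exact ht𝔴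
  set mkK := Ideal.Quotient.mk (Ideal.span {t}) with hmkK
  have hker : RingHom.ker mkK ≤ 𝔴 := by rw [hmkK, Ideal.mk_ker]; exact hK𝔴
  set 𝔴bar : Ideal (B ⧸ Ideal.span {t}) := 𝔴.map mkK with h𝔴bar
  haveI : 𝔴bar.IsPrime := Ideal.map_isPrime_of_surjective Ideal.Quotient.mk_surjective hker
  have hcomap𝔴 : 𝔴bar.comap mkK = 𝔴 := by
    rw [h𝔴bar, Ideal.comap_map_of_surjective _ Ideal.Quotient.mk_surjective]
    refine le_antisymm (sup_le le_rfl fun b hb => hker ?_) le_sup_left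
    rw [← RingHom.ker_eq_comap_bot] at hb
    exact hb
  set 𝔫 : Ideal (MvPolynomial {j : Fin 3 // j ≠ i} (ResidueField R)) := 𝔴bar.comap θ with h𝔫
  haveI h𝔫prime : 𝔫.IsPrime := Ideal.IsPrime.comap _
  have hmap𝔫 : 𝔫.map θ = 𝔴bar := by
    rw [h𝔫, Ideal.map_comap_of_surjective θ θ.surjective]
  have hXZ : MvPolynomial.X sZ ∈ 𝔫 := by
    rw [h𝔫, Ideal.mem_comap, hθX]
    exact Ideal.mem_map_of_mem _ hz
  -- the trace `𝔫₀ = (π)` of `𝔫` on `κ[Y]`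
  set ι : (ResidueField R)[X] →+* MvPolynomial {j : Fin 3 // j ≠ i} (ResidueField R) :=
    (Polynomial.aeval (MvPolynomial.X sY) :
      (ResidueField R)[X] →ₐ[ResidueField R] MvPolynomial {j : Fin 3 // j ≠ i} (ResidueField R)).toRingHom
    with hι
  have hιC : ∀ r : ResidueField R, ι (C r) = MvPolynomial.C r := fun r => by
    rw [hι, AlgHom.toRingHom_eq_coe, RingHom.coe_coe, Polynomial.aeval_C, MvPolynomial.algebraMap_eq]
  have hιX : ι X = MvPolynomial.X sY := by
    rw [hι, AlgHom.toRingHom_eq_coe, RingHom.coe_coe, Polynomial.aeval_X]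
  have h𝔫eq : 𝔫 = Ideal.span {MvPolynomial.X sZ} ⊔ (𝔫.comap ι).map ι := ideal_eq_span_X_sup_map sY sZ hσ 𝔫 hXZ
  set 𝔫₀ : Ideal (ResidueField R)[X] := 𝔫.comap ι with h𝔫₀
  haveI : 𝔫₀.IsPrime := Ideal.IsPrime.comap _
  haveI : 𝔫₀.IsPrincipal := IsPrincipalIdealRing.principal 𝔫₀
  set π : (ResidueField R)[X] := Submodule.IsPrincipal.generator 𝔫₀ with hπdef
  have h𝔫₀eq : 𝔫₀ = Ideal.span {π} := (Ideal.span_singleton_generator 𝔫₀).symm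
  -- `𝔴 = (e₂, bπ) + (t)` for a lift `bπ` of `θ (ι π)`
  obtain ⟨bπ, hbπ⟩ := Ideal.Quotient.mk_surjective (I := Ideal.span {t}) (θ (ι π))
  have h𝔴eq : 𝔴 = Ideal.span {e 2, bπ} ⊔ Ideal.span {t} := by
    have h1 : 𝔴bar = Ideal.span {mkK (e 2), mkK bπ} := by
      have hA : (Ideal.span {MvPolynomial.X sZ}).map θ = Ideal.span {mkK (e 2)} := by
        rw [Ideal.map_span, Set.image_singleton, hθX]
      have hB : ((Ideal.span {π}).map ι).map θ = Ideal.span {mkK bπ} := by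
        rw [Ideal.map_span, Set.image_singleton, Ideal.map_span, Set.image_singleton, hbπ]
      rw [← hmap𝔫, h𝔫eq, h𝔫₀eq, Ideal.map_sup, hA, hB, Ideal.span_insert]
    have h2 : Ideal.span {mkK (e 2), mkK bπ} = (Ideal.span {e 2, bπ}).map mkK := by
      rw [Ideal.map_span, Set.image_insert_eq, Set.image_singleton]
    rw [← hcomap𝔴, h1, h2, Ideal.comap_map_of_surjective _ Ideal.Quotient.mk_surjective, ← RingHom.ker_eq_comap_bot,
      Ideal.mk_ker]
  -- membership helpers for the small generating sets
  have m2a : alg t ∈ ({alg (e 2), alg t} : Set L) := Set.mem_insert_of_mem _ (Set.mem_singleton _)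
  have m2b : alg (e 2) ∈ ({alg (e 2), alg t} : Set L) := Set.mem_insert _ _
  -- case `π = 0` is impossible: then `𝔪_L = (e₂, t)` has at most two generators
  have hπ0 : π ≠ 0 := by
    intro hπ0
    have hbπK : bπ ∈ Ideal.span {t} := by
      rw [← Ideal.Quotient.eq_zero_iff_mem, hbπ, hπ0, map_zero, map_zero]
    have h𝔴le : 𝔴 ≤ Ideal.span {e 2, t} := by
      rw [h𝔴eq]
      refine sup_le ?_ ?_
      · rw [Ideal.span_le]
        rintro b (rfl | rfl)
        · exact Ideal.subset_span (Set.mem_insert _ _)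
        · obtain ⟨r, rfl⟩ := Ideal.mem_span_singleton'.mp hbπK
          exact Ideal.mul_mem_left _ _ (Ideal.subset_span (Set.mem_insert_of_mem _ (Set.mem_singleton _)))
      · rw [Ideal.span_le, Set.singleton_subset_iff]
        exact Ideal.subset_span (Set.mem_insert_of_mem _ (Set.mem_singleton _))
    have hmLle : maximalIdeal L ≤ Ideal.span {alg (e 2), alg t} := by
      rw [hmL]
      refine (Ideal.map_mono h𝔴le).trans ?_
      rw [Ideal.map_span, Set.image_insert_eq, Set.image_singleton]
    have hmLge : Ideal.span {alg (e 2), alg t} ≤ maximalIdeal L := by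
      rw [Ideal.span_le]
      rintro b (rfl | rfl)
      · exact (hmem _).mpr hz
      · exact (hmem _).mpr ht𝔴
    have heq : maximalIdeal L = Ideal.span {alg (e 2), alg t} := le_antisymm hmLle hmLge
    have hfin : ({alg (e 2), alg t} : Set L).Finite := (Set.finite_singleton _).insert _
    have hle2 : (maximalIdeal L).spanFinrank ≤ 2 := by
      rw [heq]
      refine (Submodule.spanFinrank_span_le_ncard_of_finite hfin).trans ?_
      refine (Set.ncard_insert_le _ _).trans ?_
      rw [Set.ncard_singleton]
    omega
  -- so `π` is a prime of `κ[Y]`; TAMENESS factors the residue polynomial as `π^μ · G₀`, `π ∤ G₀`, `μ < p`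
  have hπprime : Prime π := Submodule.IsPrincipal.prime_generator_of_isPrime 𝔫₀ (by
    rw [h𝔫₀eq]; exact fun h => hπ0 (Ideal.span_singleton_eq_bot.mp h))
  obtain ⟨μ, G₀, hμp, hFeq, hndvd⟩ :=
    exists_eq_pow_mul_of_tame hd2 (natDegree_sum_C_mul_X_pow_le (fun k => residue R (a k)) u hu) htame hπprime
  have hG₀ : ι G₀ ∉ 𝔫 := by
    intro h
    have : G₀ ∈ 𝔫₀ := h
    rw [Submodule.IsPrincipal.mem_iff_generator_dvd 𝔫₀] at this
    exact hndvd this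
  obtain ⟨bG, hbG⟩ := Ideal.Quotient.mk_surjective (I := Ideal.span {t}) (θ (ι G₀))
  -- the chart element `fB = Σ φ(a_k) e_{i'}^{u_k}` reduces to `θ (ι F̄)`
  set fB : B := ∑ k ∈ Finset.range (d + 1), φ (a k) * e i' ^ (u k) with hfB
  have hfBbar : mkK fB = θ (ι (∑ k ∈ Finset.range (d + 1), C (residue R (a k)) * X ^ (u k))) := by
    rw [hfB, map_sum, map_sum, map_sum]
    refine Finset.sum_congr rfl fun k _ => ?_
    rw [map_mul, map_pow, map_mul, map_pow, hιC, hιX, map_mul, map_pow, hθC, hθX]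
  have hdiffK : fB - bπ ^ μ * bG ∈ Ideal.span {t} := by
    rw [← Ideal.Quotient.eq_zero_iff_mem, map_sub, map_mul, map_pow, hfBbar, hbπ, hbG, hFeq, map_mul, map_pow,
      map_mul, map_pow, sub_self]
  -- transport to `L`
  refine ⟨alg bπ, alg bG, μ, hμp, ?_, ?_, ?_⟩
  · -- `G` is a unit: `bG ∉ 𝔴`
    refine (hunit bG).mpr fun hbG𝔴 => hG₀ ?_
    rw [h𝔫, Ideal.mem_comap, ← hbG]
    exact Ideal.mem_map_of_mem _ hbG𝔴
  · -- `𝔪_L = (t, ρ, e₂)`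
    apply le_antisymm
    · rw [Ideal.span_le]
      rintro b (rfl | rfl | rfl)
      · exact (hmem _).mpr ht𝔴
      · refine (hmem _).mpr ?_
        rw [h𝔴eq]
        exact Ideal.mem_sup_left (Ideal.subset_span (Set.mem_insert_of_mem _ (Set.mem_singleton _)))
      · exact (hmem _).mpr hz
    · have m3a : alg t ∈ ({alg t, alg bπ, alg (e 2)} : Set L) := Set.mem_insert _ _
      have m3b : alg bπ ∈ ({alg t, alg bπ, alg (e 2)} : Set L) := Set.mem_insert_of_mem _ (Set.mem_insert _ _)
      have m3c : alg (e 2) ∈ ({alg t, alg bπ, alg (e 2)} : Set L) :=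
        Set.mem_insert_of_mem _ (Set.mem_insert_of_mem _ (Set.mem_singleton _))
      rw [hmL, h𝔴eq, Ideal.map_sup, Ideal.map_span, Set.image_insert_eq, Set.image_singleton, Ideal.map_span,
        Set.image_singleton]
      refine sup_le ?_ ?_
      · rw [Ideal.span_le]
        rintro b (rfl | rfl)
        · exact Ideal.subset_span m3c
        · exact Ideal.subset_span m3b
      · rw [Ideal.span_le, Set.singleton_subset_iff]
        exact Ideal.subset_span m3a
  · -- `Σ φ(a_k) e_{i'}^{u_k} − ρ^μ G ∈ (t)`
    obtain ⟨r, hr⟩ := Ideal.mem_span_singleton'.mp hdiffK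
    have himg : alg fB - alg bπ ^ μ * alg bG = alg r * alg t := by
      rw [← map_pow, ← map_mul, ← map_sub, ← hr, map_mul]
    have hfBimg : alg fB = ∑ k ∈ Finset.range (d + 1), alg (φ (a k)) * alg (e i') ^ (u k) := by
      rw [hfB, map_sum]
      refine Finset.sum_congr rfl fun k _ => ?_
      rw [map_mul, map_pow]
    rw [← hfBimg, himg]
    exact Ideal.mul_mem_left _ _ (Ideal.mem_span_singleton_self _)

/-! ## 3. The Rees chart is such a datum -/

/-- **[OURS · L1 W4.6 rung (iii-2)] The Rees chart over a TAME window point supplies the data of `core`.** `R` regular local of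
embedding dimension `3` with regular system of parameters `c`; chart letter `i`, free letter `i'` (`i, i' ≠ 2` distinct); coefficients
`a_k` and free exponents `u_k ≤ d` (`d < 2p`) whose residue polynomial `Σ ā_k X^{u_k}` is TAME; `𝔴` a prime of the chart ring over
`𝔪_R`, `L` its local ring, of embedding dimension `3`, with `e₂ ∈ 𝔪_L`. Then `L` is regular and there are `ρ, G ∈ L`, `μ < p` with
`𝔪_L = (c_i, ρ, e₂)`, `G` a unit and `Σ_k a_k e_{i'}^{u_k} − ρ^μ G ∈ (c_i)`. NOT a statement of the manuscript. [folklore] -/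
theorem exists_core_data (p : ℕ) [Fact p.Prime] (h3 : (maximalIdeal R).spanFinrank = 3) (c : Fin 3 → R)
    (hc : Ideal.span (Set.range c) = maximalIdeal R) {i i' : Fin 3} (hi : i ≠ 2) (hi' : i' ≠ 2) (hii' : i ≠ i')
    {d : ℕ} (hd2 : d < 2 * p) (a : ℕ → R) (u : ℕ → ℕ) (hu : ∀ k, u k ≤ d)
    (htame : ∀ τ : ResidueField R, ¬ (X - C τ) ^ p ∣
      ∑ k ∈ Finset.range (d + 1), C (residue R (a k)) * X ^ (u k))
    (𝔴 : Ideal (chartRing c i)) [𝔴.IsPrime] (h𝔴 : 𝔴.comap (chartBase c i) = maximalIdeal R)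
    (L : Type u) [CommRing L] [IsLocalRing L] [Algebra (chartRing c i) L] [IsLocalization.AtPrime L 𝔴]
    (h3L : (maximalIdeal L).spanFinrank = 3)
    (hz : (algebraMap (chartRing c i) L : chartRing c i →+* L) (chartGen c i 2) ∈ maximalIdeal L) :
    IsRegularLocalRing L ∧
    ∃ (ρ G : L) (μ : ℕ), μ < p ∧ IsUnit G ∧
      Ideal.span {(algebraMap (chartRing c i) L : chartRing c i →+* L) (chartBase c i (c i)), ρ,
          (algebraMap (chartRing c i) L : chartRing c i →+* L) (chartGen c i 2)} = maximalIdeal L ∧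
      (∑ k ∈ Finset.range (d + 1), (algebraMap (chartRing c i) L : chartRing c i →+* L) (chartBase c i (a k)) *
          (algebraMap (chartRing c i) L : chartRing c i →+* L) (chartGen c i i') ^ (u k)) - ρ ^ μ * G ∈
        Ideal.span {(algebraMap (chartRing c i) L : chartRing c i →+* L) (chartBase c i (c i))} := by
  classical
  -- the padded rsop and quasi-regularity
  have hz0 : Ideal.span (Set.range (Fin.append c (fun k : Fin 0 => Fin.elim0 k : Fin 0 → R))) = maximalIdeal R := by
    rw [span_range_append_elim0]; exact hc
  have hd0 : (maximalIdeal R).spanFinrank = 3 + 0 := by rw [h3]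
  have hqr : IsQuasiRegular c := isQuasiRegular_centre c (fun k : Fin 0 => Fin.elim0 k) hz0 hd0
  -- `L` is regular: the chart family with no extra letters
  have hrsop := isRsopPart_chartFamily_reesChart c i (fun k : Fin 0 => Fin.elim0 k) hz0 hd0 𝔴 h𝔴 L
    (a := 0) (fun k : Fin 0 => Fin.elim0 k) (Function.injective_of_subsingleton _) (fun k => Fin.elim0 k)
  refine ⟨hrsop.isRegularLocalRing, ?_⟩
  have hci𝔴 : chartBase c i (c i) ∈ 𝔴 := by
    have : c i ∈ 𝔴.comap (chartBase c i) := by rw [h𝔴, ← hc]; exact Ideal.subset_span ⟨i, rfl⟩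
    exact this
  have he2𝔴 : chartGen c i 2 ∈ 𝔴 := (IsLocalization.AtPrime.to_map_mem_maximal_iff L 𝔴 _).mp hz
  -- the exceptional plane over the residue field: `κ[Y, Z] ≃ B/(c_i)` (tree `chartQuotEquiv` after `R/(c) = R/𝔪 = κ`)
  let θ : MvPolynomial {j : Fin 3 // j ≠ i} (ResidueField R) ≃+* chartRing c i ⧸ Ideal.span {chartBase c i (c i)} :=
    (MvPolynomial.mapEquiv {j : Fin 3 // j ≠ i} (Ideal.quotEquivOfEq hc).symm).trans (chartQuotEquiv c i hqr)
  have hθC : ∀ r : R, θ (MvPolynomial.C (residue R r)) =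
      Ideal.Quotient.mk (Ideal.span {chartBase c i (c i)}) (chartBase c i r) := fun r => by
    show chartQuotMap c i (MvPolynomial.map (Ideal.quotEquivOfEq hc).symm.toRingHom (MvPolynomial.C (residue R r))) = _
    have : (Ideal.quotEquivOfEq hc).symm.toRingHom (residue R r) = Ideal.Quotient.mk (Ideal.span (Set.range c)) r := by
      show (Ideal.quotEquivOfEq hc).symm (Ideal.Quotient.mk (maximalIdeal R) r) = _
      rw [Ideal.quotEquivOfEq_symm, Ideal.quotEquivOfEq_mk]
    rw [MvPolynomial.map_C, this, chartQuotMap_C]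
  have hθX : ∀ s : {j : Fin 3 // j ≠ i}, θ (MvPolynomial.X s) =
      Ideal.Quotient.mk (Ideal.span {chartBase c i (c i)}) (chartGen c i s.1) := fun s => by
    show chartQuotMap c i (MvPolynomial.map (Ideal.quotEquivOfEq hc).symm.toRingHom (MvPolynomial.X s)) = _
    rw [MvPolynomial.map_X, chartQuotMap_X]
  exact exists_core_data_of_chartDatum p (chartBase c i) (algebraMap (chartRing c i) L) (chartBase c i (c i))
    (chartGen c i) hi hi' hii' θ hθC hθX 𝔴 hci𝔴 he2𝔴
    (fun b => IsLocalization.AtPrime.to_map_mem_maximal_iff L 𝔴 b)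
    (fun b => (IsLocalization.AtPrime.isUnit_to_map_iff L 𝔴 b).trans Iff.rfl)
    (IsLocalization.AtPrime.map_eq_maximalIdeal 𝔴 L).symm h3L hd2 a u hu htame

end Summit.ResolutionOfSingularities.ResolutionOfSingularities.Theorems.CampaignW46.MohWindowSurface

end
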